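import Summits.AtomisticToContinuum.HydrodynamicLimit.Theorems.EnskogAdjointDualityAdjointEnskogTestFamilyRCorrectorPosition
import Summits.AtomisticToContinuum.HydrodynamicLimit.Theorems.EnskogAdjointDualityDualityReductionMaxwellian
import HarnessLib

/-!
# K2R transfer reduction I: the Fubini exchanges `(x, v, ω, w) → (ω, x, v, w)` of the Enskog pairing

Route `EnskogAdjointDuality` of `AtomisticToContinuum/HydrodynamicLimit`, crux `AdjointEnskogTestFamilyR`
(stmt-AtomisticToContinuum-11592, "K2R"), line `birth`, stub `stub_transferReduction` (G3a).
In the pairing `∫_{𝕋³} ∫ f(x,v) ∫_{S²} ∫ ((v−w)·ω)₊ Y(x,ω) f(x+εω, w) [κ(x,v′) + κ(x+εω,w′) − κ(x,v) − κ(x+εω,w)]`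
of the test-side Enskog operator against a local Maxwellian background `f = ρ₀ M_{1,θ₀,u₀}` (continuous
profiles, `θ₀ > 0`, bounded continuous contact factor `Y`, continuous `κ` of quadratic velocity growth)
the impact direction `ω` may be integrated LAST:

* `k2r_tr_pairing_swap` — `∫ x ∫ v f · λ ∫ ω ∫ w (⋯) = λ ∫ ω ∫ x ∫ v f ∫ w (⋯)`;
* `stub_transferReduction_swap` — the registered sub-goal (closed form of `k2r_tr_pairing_swap`).

Mechanism: the `w`-integral is dominated by a Gaussian moment `K (1+|v|²)²` uniformly in `(x, ω)`
(`abs_increment_le`), so `(v, ω) ↦ f(x,v) ∫ w (⋯)` is integrable on `ℝ³ × S²` for each `x` (swap `v ↔ ω`),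
and `(x, ω) ↦ ∫ v f ∫ w (⋯)` is bounded and strongly measurable on the finite measure space `𝕋³ × S²`
(`StronglyMeasurable.integral_prod_right'` from joint continuity of the integrand; swap `x ↔ ω`).

References: C. Cercignani, R. Illner, M. Pulvirenti, *The Mathematical Theory of Dilute Gases* (1994), §3.1
[CIP1994].
-/

noncomputable section

open MeasureTheory ProbabilityTheory Metric Set Filter Topology Function
open scoped InnerProductSpace ENNReal

namespace Summit.AtomisticToContinuum.HydrodynamicLimit.Theorems.EnskogAdjointDuality

open Literature.Analysis.FluidPDE Literature.MathematicalPhysics.KineticTheory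

/-- **Fubini for the Enskog pairing: the impact direction last.** For continuous profiles
`ρ₀, θ₀, u₀` on `𝕋³` with `|ρ₀| ≤ R`, `0 < θ₀ ≤ Θ`, `‖u₀‖ ≤ U`, a continuous contact factor `|Y(x, ω)| ≤ Ȳ`,
a continuous `κ(x, v)` with `|κ| ≤ C(1+|v|²)`, and constants `ε, λ`:
`∫_{𝕋³} ∫ ρ₀(x)M_x(v) · λ ∫_{S²} ∫ ((v−w)·ω)₊ Y(x,ω) ρ₀(y)M_y(w) [κ(x,v′) + κ(y,w′) − κ(x,v) − κ(y,w)] dw dσ dv dx`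
`= λ ∫_{S²} ∫_{𝕋³} ∫ ρ₀(x)M_x(v) ∫ ((v−w)·ω)₊ Y(x,ω) ρ₀(y)M_y(w) [⋯] dw dv dx dσ`, `y = x + εω`
(Gaussian-moment domination of the `w`-integral, finiteness of `S²` and of Haar measure on `𝕋³`).
[cite: CIP1994, §3.1] -/
theorem k2r_tr_pairing_swap {ρ₀ θ₀ : T3 → ℝ} {u₀ : T3 → V3} (hρc : Continuous ρ₀) (hθc : Continuous θ₀)
    (huc : Continuous u₀) {R Θ U : ℝ} (hρb : ∀ x, |ρ₀ x| ≤ R) (hθpos : ∀ x, 0 < θ₀ x)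
    (hθΘ : ∀ x, θ₀ x ≤ Θ) (hub : ∀ x, ‖u₀ x‖ ≤ U) {Yf : T3 → sphere (0 : V3) 1 → ℝ}
    (hYc : Continuous (uncurry Yf)) {Yb : ℝ} (hYb : ∀ x ω, |Yf x ω| ≤ Yb) {κ : T3 → V3 → ℝ}
    (hκc : Continuous (uncurry κ)) {C : ℝ} (hκb : ∀ x v, |κ x v| ≤ C * (1 + ‖v‖ ^ 2)) (ε lam : ℝ) :
    ∫ x, ∫ v, ρ₀ x * localMaxwellian 1 (θ₀ x) (u₀ x) v *
        (lam * ∫ ω : sphere (0 : V3) 1, (∫ w, max ⟪v - w, (ω : V3)⟫_ℝ 0 * Yf x ω *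
          (ρ₀ ((Torus.geometry (Fin 3)).translate x (ε • (ω : V3))) *
            localMaxwellian 1 (θ₀ ((Torus.geometry (Fin 3)).translate x (ε • (ω : V3))))
              (u₀ ((Torus.geometry (Fin 3)).translate x (ε • (ω : V3)))) w) *
          (κ x (v - ⟪v - w, (ω : V3)⟫_ℝ • (ω : V3)) +
            κ ((Torus.geometry (Fin 3)).translate x (ε • (ω : V3))) (w + ⟪v - w, (ω : V3)⟫_ℝ • (ω : V3)) -
            κ x v - κ ((Torus.geometry (Fin 3)).translate x (ε • (ω : V3))) w)) ∂sphereMeasure) =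
      lam * ∫ ω : sphere (0 : V3) 1, (∫ x, ∫ v, ρ₀ x * localMaxwellian 1 (θ₀ x) (u₀ x) v *
        ∫ w, max ⟪v - w, (ω : V3)⟫_ℝ 0 * Yf x ω *
          (ρ₀ ((Torus.geometry (Fin 3)).translate x (ε • (ω : V3))) *
            localMaxwellian 1 (θ₀ ((Torus.geometry (Fin 3)).translate x (ε • (ω : V3))))
              (u₀ ((Torus.geometry (Fin 3)).translate x (ε • (ω : V3)))) w) *
          (κ x (v - ⟪v - w, (ω : V3)⟫_ℝ • (ω : V3)) +
            κ ((Torus.geometry (Fin 3)).translate x (ε • (ω : V3))) (w + ⟪v - w, (ω : V3)⟫_ℝ • (ω : V3)) -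
            κ x v - κ ((Torus.geometry (Fin 3)).translate x (ε • (ω : V3))) w)) ∂sphereMeasure := by
  haveI := isFiniteMeasure_sphereMeasure (E := V3)
  obtain ⟨CG, hCG0, hCG⟩ := exists_integral_one_add_norm_sq_sq_gaussMeasure_le U Θ
  obtain ⟨x₀⟩ : Nonempty T3 := inferInstance
  have hC : 0 ≤ C := by
    have h := (abs_nonneg _).trans (hκb x₀ 0)
    simpa using h
  have hR0 : 0 ≤ R := (abs_nonneg _).trans (hρb x₀)
  -- notation: the Maxwellian field and the contact shift
  set Mf : T3 → V3 → ℝ := fun x v => localMaxwellian 1 (θ₀ x) (u₀ x) v with hMf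
  have hMfc : Continuous (uncurry Mf) :=
    continuous_localMaxwellian_param (hθc.comp continuous_fst) (fun _ => hθpos _) (huc.comp continuous_fst)
      continuous_snd
  have hMf0 : ∀ x v, 0 ≤ Mf x v := fun x v => localMaxwellian_nonneg zero_le_one (hθpos x).le _ _
  set τ : T3 → sphere (0 : V3) 1 → T3 := fun x ω => (Torus.geometry (Fin 3)).translate x (ε • (ω : V3))
    with hτ
  have hτc : Continuous (uncurry τ) := continuous_torus_translate_sphere ε
  ----------------------------------------------------------------
  -- the joint integrand `H (((x, ω), v), w)` and the inner integral `I ((x, ω), v) = ∫ H dw`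
  ----------------------------------------------------------------
  set H : ((T3 × sphere (0 : V3) 1) × V3) × V3 → ℝ := fun r =>
    max ⟪r.1.2 - r.2, (r.1.1.2 : V3)⟫_ℝ 0 * uncurry Yf r.1.1 *
      (ρ₀ (uncurry τ r.1.1) * uncurry Mf (uncurry τ r.1.1, r.2)) *
      (uncurry κ (r.1.1.1, r.1.2 - ⟪r.1.2 - r.2, (r.1.1.2 : V3)⟫_ℝ • (r.1.1.2 : V3)) +
        uncurry κ (uncurry τ r.1.1, r.2 + ⟪r.1.2 - r.2, (r.1.1.2 : V3)⟫_ℝ • (r.1.1.2 : V3)) -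
        uncurry κ (r.1.1.1, r.1.2) - uncurry κ (uncurry τ r.1.1, r.2)) with hH
  have hHc : Continuous H := by
    have hx : Continuous fun r : ((T3 × sphere (0 : V3) 1) × V3) × V3 => r.1.1.1 := by fun_prop
    have hv : Continuous fun r : ((T3 × sphere (0 : V3) 1) × V3) × V3 => r.1.2 := by fun_prop
    have hw : Continuous fun r : ((T3 × sphere (0 : V3) 1) × V3) × V3 => r.2 := by fun_prop
    have hω : Continuous fun r : ((T3 × sphere (0 : V3) 1) × V3) × V3 => (r.1.1.2 : V3) := by fun_prop
    have hxω : Continuous fun r : ((T3 × sphere (0 : V3) 1) × V3) × V3 => r.1.1 := by fun_prop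
    have hy : Continuous fun r : ((T3 × sphere (0 : V3) 1) × V3) × V3 => uncurry τ r.1.1 := hτc.comp hxω
    have hin : Continuous fun r : ((T3 × sphere (0 : V3) 1) × V3) × V3 =>
        ⟪r.1.2 - r.2, (r.1.1.2 : V3)⟫_ℝ := (hv.sub hw).inner hω
    simp only [hH]
    refine (((hin.max continuous_const).mul (hYc.comp hxω)).mul
      ((hρc.comp hy).mul (hMfc.comp (hy.prodMk hw)))).mul ?_
    exact (((hκc.comp (hx.prodMk (hv.sub (hin.smul hω)))).add
      (hκc.comp (hy.prodMk (hw.add (hin.smul hω))))).sub (hκc.comp (hx.prodMk hv))).sub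
      (hκc.comp (hy.prodMk hw))
  set I : (T3 × sphere (0 : V3) 1) × V3 → ℝ := fun p => ∫ w, H (p, w) with hI
  have hIm : StronglyMeasurable I := hHc.stronglyMeasurable.integral_prod_right'
  have hIeq : ∀ (x : T3) (ω : sphere (0 : V3) 1) (v : V3), I ((x, ω), v) =
      ∫ w, max ⟪v - w, (ω : V3)⟫_ℝ 0 * Yf x ω * (ρ₀ (τ x ω) * Mf (τ x ω) w) *
        (κ x (v - ⟪v - w, (ω : V3)⟫_ℝ • (ω : V3)) + κ (τ x ω) (w + ⟪v - w, (ω : V3)⟫_ℝ • (ω : V3)) -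
          κ x v - κ (τ x ω) w) := fun x ω v => rfl
  -- pointwise bound on the inner integral (Gaussian moment of the partner Maxwellian)
  set K₁ : ℝ := Yb * R * (18 * C) * CG with hK₁
  have hIbd : ∀ (x : T3) (ω : sphere (0 : V3) 1) (v : V3), |I ((x, ω), v)| ≤ K₁ * (1 + ‖v‖ ^ 2) ^ 2 := by
    intro x ω v
    set y := τ x ω
    have hθy := hθpos y
    have hYb0 : 0 ≤ Yb := (abs_nonneg _).trans (hYb x ω)
    have hdom : ∀ w : V3, ‖max ⟪v - w, (ω : V3)⟫_ℝ 0 * Yf x ω * (ρ₀ y * Mf y w) *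
        (κ x (v - ⟪v - w, (ω : V3)⟫_ℝ • (ω : V3)) + κ y (w + ⟪v - w, (ω : V3)⟫_ℝ • (ω : V3)) -
          κ x v - κ y w)‖ ≤
        Mf y w * (Yb * R * (18 * C) * (1 + ‖v‖ ^ 2) ^ 2 * (1 + ‖w‖ ^ 2) ^ 2) := by
      intro w
      have hM0 : 0 ≤ Mf y w := hMf0 y w
      have hmax : |max ⟪v - w, (ω : V3)⟫_ℝ 0| ≤ (1 + ‖v‖ ^ 2) * (1 + ‖w‖ ^ 2) :=
        k2r_abs_posPart_inner_le ω v w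
      have hinc := abs_increment_le (φ := κ) hκb x y v w ω
      have hP0 : 0 ≤ (1 + ‖v‖ ^ 2) * (1 + ‖w‖ ^ 2) := by positivity
      rw [Real.norm_eq_abs, abs_mul, abs_mul, abs_mul, abs_mul, abs_of_nonneg hM0]
      have i1 : |max ⟪v - w, (ω : V3)⟫_ℝ 0| * |Yf x ω| ≤ ((1 + ‖v‖ ^ 2) * (1 + ‖w‖ ^ 2)) * Yb :=
        mul_le_mul hmax (hYb x ω) (abs_nonneg _) hP0
      have i2 : |ρ₀ y| * Mf y w ≤ R * Mf y w := mul_le_mul_of_nonneg_right (hρb y) hM0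
      have i3 : |max ⟪v - w, (ω : V3)⟫_ℝ 0| * |Yf x ω| * (|ρ₀ y| * Mf y w) ≤
          ((1 + ‖v‖ ^ 2) * (1 + ‖w‖ ^ 2)) * Yb * (R * Mf y w) :=
        mul_le_mul i1 i2 (mul_nonneg (abs_nonneg _) hM0) (mul_nonneg hP0 hYb0)
      calc |max ⟪v - w, (ω : V3)⟫_ℝ 0| * |Yf x ω| * (|ρ₀ y| * Mf y w) *
            |κ x (v - ⟪v - w, (ω : V3)⟫_ℝ • (ω : V3)) + κ y (w + ⟪v - w, (ω : V3)⟫_ℝ • (ω : V3)) -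
              κ x v - κ y w|
          ≤ ((1 + ‖v‖ ^ 2) * (1 + ‖w‖ ^ 2)) * Yb * (R * Mf y w) *
            (18 * C * ((1 + ‖v‖ ^ 2) * (1 + ‖w‖ ^ 2))) :=
            mul_le_mul i3 hinc (abs_nonneg _) (mul_nonneg (mul_nonneg hP0 hYb0) (mul_nonneg hR0 hM0))
        _ = _ := by ring
    have hint : Integrable (fun w : V3 => Mf y w *
        (Yb * R * (18 * C) * (1 + ‖v‖ ^ 2) ^ 2 * (1 + ‖w‖ ^ 2) ^ 2)) := by
      simp only [hMf]
      rw [integrable_localMaxwellian_mul_iff hθy]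
      exact (integrable_one_add_norm_sq_pow_gaussMeasure _ _ 2).const_mul _
    have h := norm_integral_le_of_norm_le hint (Eventually.of_forall hdom)
    simp only [hMf] at h
    rw [Real.norm_eq_abs, integral_localMaxwellian_mul_eq_integral_gaussMeasure hθy, integral_const_mul] at h
    rw [hIeq]
    refine h.trans ?_
    have hCGy := hCG (u₀ y) (θ₀ y) (hub y) hθy (hθΘ y)
    have : 0 ≤ Yb * R * (18 * C) * (1 + ‖v‖ ^ 2) ^ 2 := by positivity
    rw [hK₁]
    nlinarith
  obtain ⟨ω₀, hω₀⟩ := (NormedSpace.sphere_nonempty (x := (0 : V3)) (r := 1)).2 zero_le_one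
  have hYb0 : 0 ≤ Yb := (abs_nonneg _).trans (hYb x₀ ⟨ω₀, hω₀⟩)
  have hK₁0 : 0 ≤ K₁ := by rw [hK₁]; positivity
  have hm₂ : ∀ x : T3, Integrable (fun v : V3 => Mf x v * (1 + ‖v‖ ^ 2) ^ 2) := fun x => by
    simp only [hMf]
    rw [integrable_localMaxwellian_mul_iff (hθpos x)]
    exact integrable_one_add_norm_sq_pow_gaussMeasure _ _ 2
  ----------------------------------------------------------------
  -- Step 1: the exchange `v ↔ ω` for each position `x`
  ----------------------------------------------------------------
  have hstep1 : ∀ x : T3,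
      ∫ v, ρ₀ x * Mf x v * (lam * ∫ ω : sphere (0 : V3) 1, I ((x, ω), v) ∂sphereMeasure) =
        lam * ∫ ω : sphere (0 : V3) 1, (∫ v, ρ₀ x * Mf x v * I ((x, ω), v)) ∂sphereMeasure := by
    intro x
    have hFi : Integrable (uncurry fun (v : V3) (ω : sphere (0 : V3) 1) => ρ₀ x * Mf x v * I ((x, ω), v))
        ((volume : Measure V3).prod sphereMeasure) := by
      have hbnd : Integrable (fun s : V3 × sphere (0 : V3) 1 =>
          R * K₁ * (Mf x s.1 * (1 + ‖s.1‖ ^ 2) ^ 2)) ((volume : Measure V3).prod sphereMeasure) :=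
        ((hm₂ x).comp_fst sphereMeasure).const_mul _
      have h1 : Continuous fun s : V3 × sphere (0 : V3) 1 => ρ₀ x * Mf x s.1 :=
        continuous_const.mul (hMfc.comp (continuous_const.prodMk continuous_fst))
      have h2 : StronglyMeasurable fun s : V3 × sphere (0 : V3) 1 => I ((x, s.2), s.1) :=
        hIm.comp_measurable ((measurable_const.prodMk measurable_snd).prodMk measurable_fst)
      refine hbnd.mono' (h1.stronglyMeasurable.mul h2).aestronglyMeasurable
        (Eventually.of_forall fun s => ?_)
      obtain ⟨v, ω⟩ := s
      have hMv : 0 ≤ Mf x v := hMf0 x v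
      simp only [Function.uncurry_apply_pair]
      rw [Real.norm_eq_abs, abs_mul, abs_mul, abs_of_nonneg hMv]
      calc |ρ₀ x| * Mf x v * |I ((x, ω), v)| ≤ R * Mf x v * (K₁ * (1 + ‖v‖ ^ 2) ^ 2) :=
            mul_le_mul (mul_le_mul_of_nonneg_right (hρb x) hMv) (hIbd x ω v) (abs_nonneg _)
              (mul_nonneg hR0 hMv)
        _ = R * K₁ * (Mf x v * (1 + ‖v‖ ^ 2) ^ 2) := by ring
    have hswap := integral_integral_swap hFi
    simp only at hswap
    calc ∫ v, ρ₀ x * Mf x v * (lam * ∫ ω : sphere (0 : V3) 1, I ((x, ω), v) ∂sphereMeasure)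
        = ∫ v, lam * ∫ ω : sphere (0 : V3) 1, ρ₀ x * Mf x v * I ((x, ω), v) ∂sphereMeasure := by
          refine integral_congr_ae (Eventually.of_forall fun v => ?_)
          simp only
          rw [integral_const_mul]
          ring
      _ = lam * ∫ ω : sphere (0 : V3) 1, (∫ v, ρ₀ x * Mf x v * I ((x, ω), v)) ∂sphereMeasure := by
          rw [integral_const_mul, hswap]
  ----------------------------------------------------------------
  -- Step 2: the exchange `x ↔ ω`
  ----------------------------------------------------------------
  set G : T3 × sphere (0 : V3) 1 → ℝ := fun s => ∫ v, ρ₀ s.1 * Mf s.1 v * I (s, v) with hG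
  have hGm : StronglyMeasurable G := by
    have h1 : Continuous fun p : (T3 × sphere (0 : V3) 1) × V3 => ρ₀ p.1.1 * Mf p.1.1 p.2 :=
      (hρc.comp (continuous_fst.comp continuous_fst)).mul
        (hMfc.comp ((continuous_fst.comp continuous_fst).prodMk continuous_snd))
    have h2 : StronglyMeasurable fun p : (T3 × sphere (0 : V3) 1) × V3 => ρ₀ p.1.1 * Mf p.1.1 p.2 * I p :=
      h1.stronglyMeasurable.mul hIm
    exact h2.integral_prod_right'
  have hGbd : ∀ s : T3 × sphere (0 : V3) 1, |G s| ≤ R * (K₁ * CG) := by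
    rintro ⟨x, ω⟩
    have h := abs_integral_localMaxwellian_mul_le (hθpos x) (u₀ x) (g := fun v => I ((x, ω), v))
      (fun v => hIbd x ω v)
    have hfac : G (x, ω) = ρ₀ x * ∫ v, Mf x v * I ((x, ω), v) := by
      simp only [hG]
      rw [← integral_const_mul]
      refine integral_congr_ae (Eventually.of_forall fun v => ?_)
      ring
    rw [hfac, abs_mul]
    refine mul_le_mul (hρb x) (h.trans ?_) (abs_nonneg _) hR0
    exact mul_le_mul_of_nonneg_left (hCG (u₀ x) (θ₀ x) (hub x) (hθpos x) (hθΘ x)) hK₁0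
  have hGi : Integrable (uncurry fun (x : T3) (ω : sphere (0 : V3) 1) => G (x, ω))
      ((volume : Measure T3).prod sphereMeasure) := by
    refine (integrable_const (R * (K₁ * CG))).mono' hGm.aestronglyMeasurable
      (Eventually.of_forall fun s => ?_)
    rw [Real.norm_eq_abs]
    exact hGbd s
  have hswap2 := integral_integral_swap hGi
  simp only at hswap2
  -- assembly
  calc ∫ x, ∫ v, ρ₀ x * localMaxwellian 1 (θ₀ x) (u₀ x) v *
        (lam * ∫ ω : sphere (0 : V3) 1, (∫ w, max ⟪v - w, (ω : V3)⟫_ℝ 0 * Yf x ω *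
          (ρ₀ ((Torus.geometry (Fin 3)).translate x (ε • (ω : V3))) *
            localMaxwellian 1 (θ₀ ((Torus.geometry (Fin 3)).translate x (ε • (ω : V3))))
              (u₀ ((Torus.geometry (Fin 3)).translate x (ε • (ω : V3)))) w) *
          (κ x (v - ⟪v - w, (ω : V3)⟫_ℝ • (ω : V3)) +
            κ ((Torus.geometry (Fin 3)).translate x (ε • (ω : V3))) (w + ⟪v - w, (ω : V3)⟫_ℝ • (ω : V3)) -
            κ x v - κ ((Torus.geometry (Fin 3)).translate x (ε • (ω : V3))) w)) ∂sphereMeasure)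
      = ∫ x, lam * ∫ ω : sphere (0 : V3) 1, G (x, ω) ∂sphereMeasure :=
        integral_congr_ae (Eventually.of_forall fun x => hstep1 x)
    _ = lam * ∫ x, ∫ ω : sphere (0 : V3) 1, G (x, ω) ∂sphereMeasure := integral_const_mul _ _
    _ = lam * ∫ ω : sphere (0 : V3) 1, (∫ x, G (x, ω)) ∂sphereMeasure := by rw [hswap2]
    _ = _ := rfl

/-! ## Registered sub-goal of stub `stub_transferReduction` proved in this file -/

/-- **Registered sub-goal `stub_transferReduction_swap`** (K2R line `birth`, stub G3a, helper): Fubini for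
the Enskog pairing with the impact direction integrated last, `k2r_tr_pairing_swap` as a closed
statement. [cite: CIP1994, §3.1] -/
theorem stub_transferReduction_swap :
    ∀ (ρ₀ θ₀ : UnitAddTorus (Fin 3) → ℝ) (u₀ : UnitAddTorus (Fin 3) → EuclideanSpace ℝ (Fin 3)), Continuous ρ₀ → Continuous θ₀ → Continuous u₀ → ∀ (R Θ U : ℝ), (∀ x, |ρ₀ x| ≤ R) → (∀ x, 0 < θ₀ x) → (∀ x, θ₀ x ≤ Θ) → (∀ x, ‖u₀ x‖ ≤ U) → ∀ (Yf : UnitAddTorus (Fin 3) → Metric.sphere (0 : EuclideanSpace ℝ (Fin 3)) 1 → ℝ), Continuous (Function.uncurry Yf) → ∀ (Yb : ℝ), (∀ x ω, |Yf x ω| ≤ Yb) → ∀ (κ : UnitAddTorus (Fin 3) → EuclideanSpace ℝ (Fin 3) → ℝ), Continuous (Function.uncurry κ) → ∀ (C : ℝ), (∀ x v, |κ x v| ≤ C * (1 + ‖v‖ ^ 2)) → ∀ (ε lam : ℝ), (∫ x : UnitAddTorus (Fin 3), ∫ v : EuclideanSpace ℝ (Fin 3), ρ₀ x * Literature.Analysis.FluidPDE.localMaxwellian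 1 (θ₀ x) (u₀ x) v * (lam * ∫ ω : Metric.sphere (0 : EuclideanSpace ℝ (Fin 3)) 1, (∫ w : EuclideanSpace ℝ (Fin 3), max (inner ℝ (v - w) ω) 0 * Yf x ω * (ρ₀ ((Literature.Analysis.FluidPDE.Torus.geometry (Fin 3)).translate x (ε • (ω : EuclideanSpace ℝ (Fin 3)))) * Literature.Analysis.FluidPDE.localMaxwellian 1 (θ₀ ((Literature.Analysis.FluidPDE.Torus.geometry (Fin 3)).translate x (ε • (ω : EuclideanSpace ℝ (Fin 3))))) (u₀ ((Literature.Analysis.FluidPDE.Torus.geometry (Fin 3)).translate x (ε • (ω : EuclideanSpace ℝ (Fin 3))))) w) * (κ x (v - inner ℝ (v - w) ω • (ω : EuclideanSpace ℝ (Fin 3))) + κ ((Literature.Analysis.FluidPDE.Torus.geometry (Fin 3)).translate x (ε • (ω : EuclideanSpace ℝ (Fin 3)))) (w + inner ℝ (v - w) ω • (ω : EuclideanSpace ℝ (Fin 3))) - κ x v - κ ((Literature.Analysis.FluidPDE.Torus.geometry (Fin 3)).translate x (ε • (ω : EuclideanSpace ℝ (Fin 3)))) w)) ∂Literature.MathematicalPhysics.KineticTheory.sphereMeasure))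 = lam * ∫ ω : Metric.sphere (0 : EuclideanSpace ℝ (Fin 3)) 1, (∫ x : UnitAddTorus (Fin 3), ∫ v : EuclideanSpace ℝ (Fin 3), ρ₀ x * Literature.Analysis.FluidPDE.localMaxwellian 1 (θ₀ x) (u₀ x) v * ∫ w : EuclideanSpace ℝ (Fin 3), max (inner ℝ (v - w) ω) 0 * Yf x ω * (ρ₀ ((Literature.Analysis.FluidPDE.Torus.geometry (Fin 3)).translate x (ε • (ω : EuclideanSpace ℝ (Fin 3)))) * Literature.Analysis.FluidPDE.localMaxwellian 1 (θ₀ ((Literature.Analysis.FluidPDE.Torus.geometry (Fin 3)).translate x (ε • (ω : EuclideanSpace ℝ (Fin 3))))) (u₀ ((Literature.Analysis.FluidPDE.Torus.geometry (Fin 3)).translate x (ε • (ω : EuclideanSpace ℝ (Fin 3))))) w) * (κ x (v - inner ℝ (v - w) ω • (ω : EuclideanSpace ℝ (Fin 3))) + κ ((Literature.Analysis.FluidPDE.Torus.geometry (Fin 3)).translate x (ε • (ω : EuclideanSpace ℝ (Fin 3)))) (w + inner ℝ (v - w) ω • (ω : EuclideanSpace ℝ (Fin 3))) - κ x v - κ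 ((Literature.Analysis.FluidPDE.Torus.geometry (Fin 3)).translate x (ε • (ω : EuclideanSpace ℝ (Fin 3)))) w)) ∂Literature.MathematicalPhysics.KineticTheory.sphereMeasure :=
  fun _ _ _ hρc hθc huc _ _ _ hρb hθpos hθΘ hub _ hYc _ hYb _ hκc _ hκb ε lam =>
    k2r_tr_pairing_swap hρc hθc huc hρb hθpos hθΘ hub hYc hYb hκc hκb ε lam

end Summit.AtomisticToContinuum.HydrodynamicLimit.Theorems.EnskogAdjointDuality

end
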